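import Mathlib
import Summits.RiemannHypothesis.RiemannHypothesis.Theorems.WeilFarCoercivityFloor
import Summits.RiemannHypothesis.RiemannHypothesis.Theorems.WeilFarFloorKappaRoot
import Summits.RiemannHypothesis.RiemannHypothesis.Theorems.WeilFarFloorSchur
import Summits.RiemannHypothesis.RiemannHypothesis.Theorems.WeilFarFloorCoshTest
import Summits.RiemannHypothesis.RiemannHypothesis.Theorems.WeilFarFloorMainTermExact
import Literature.NumberTheory.LFunctions.MertensFirstVonMangoldtUpper
import Literature.NumberTheory.Transcendental.ZetaLinearFormsCriterion
import HarnessLib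

/-!
# The floor law at leading order, unconditionally: `λ_max(a) ~ e^a ~ L(a)` (prime number theorem)

Helper file (`--supports stmt-RiemannHypothesis-0098`, lead-track anchor: Weil-positivity window ladder, format-C far bound),
RH-free, pure proofs.  Seat rh-explicit-weil-1 gen9 (memo `run/shared/lean/pub/rh-explicit/rh-explicit-weil-1/FORMAT-K3.md` §10.12).
The floor law C-XIII (`WeilFarCoercivityFloor.FarFloorDiscrepancyLe C 1`) says `λ_max(a) = L(a) − 2γ_E + O(1)`, `L = pntFloor`.
Its two halves at order `O(1)` are tied to RH (`WeilFarFloorLawRH`: the upper half implies RH; `WeilFarFloorCoshTestRH`: RH gives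
the lower half up to `O(a²)`).  This file proves what holds WITHOUT any hypothesis, from the tree's prime number theorem
(`Literature.NumberTheory.LFunctions.chebyshevPsi_isEquivalent_holds`, Wiener–Ikehara; used through `Literature.NumberTheory.Transcendental.tendsto_psi_div`):

* `farCoercivityFloor_le_linear` — the Schur test (`WeilFarFloorSchur`, weight `cosh(x/2)`) turns ANY linear majorant
  `ψ(X) ≤ αX + K` (`X ≥ 1`) into `λ_max(a) ≤ α·e^a + 2a + K + 39/50` (`a > 0`);
* `farCoercivityFloor_le_of_pnt` — `∀ ε > 0 ∃ K ∀ a > 0, λ_max(a) ≤ (1 + ε)e^a + 2a + K`;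
* `farCoercivityFloor_ge_of_pnt` — `∀ ε > 0, (1 − ε)e^a ≤ λ_max(a)` for all large `a` (the `cosh(x/2)·1_{[−a,a]}` test function of
  `WeilFarFloorCoshTest`, whose prime sum is `≥ −e^{−a}ψ(e^{2a}) + ½∫₁^{e^{2a}} ψ(t)dt/t`);
* ★ `tendsto_farCoercivityFloor_div_exp` — **`λ_max(a)/e^a → 1`**; `tendsto_farCoercivityFloor_div_pntFloor` — **`λ_max(a)/L(a) → 1`**;
  `tendsto_farFloorDiscrepancy_div_exp` — `(λ_max(a) − (L(a) − 2γ_E))/e^a → 0`: the floor law holds at relative order `o(1)`.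

(Chebyshev-strength inputs gave the constants `[0.90, 1.106]`: `FloorCosh.farCoercivityFloor_ge_coshTest`,
`FloorSchur.farCoercivityFloor_le_chebyshev`.)  Standard axioms only.
-/

set_option linter.dupNamespace false
set_option autoImplicit false

noncomputable section

open MeasureTheory Set Finset Filter Topology
open scoped Real BigOperators ArithmeticFunction.vonMangoldt Chebyshev

namespace Summit.RiemannHypothesis.RiemannHypothesis.Theorems.WeilFormatC

namespace FloorAsymptotic

open FloorSchur FloorCosh

variable {a : ℝ}

/-! ## §1 The Schur bound with a linear majorant of `ψ` -/

/-- **Schur bound for the weight `cosh(x/2)` from ANY linear majorant `ψ(X) ≤ αX + K` (`X ≥ 1`)**: on `[−a, a]`,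
`½·[e^{x/2}(M(e^{a+x}) + ψ(e^{a−x})) + e^{−x/2}(ψ(e^{a+x}) + M(e^{a−x}))] ≤ (α·e^a + 2a + K + 39/50)·cosh(x/2)`. -/
theorem schurBound_cosh_linear {α K : ℝ} (hψ : ∀ X : ℝ, 1 ≤ X → ψ X ≤ α * X + K) {x : ℝ} (hx : x ∈ Icc (-a) a) :
    (Real.exp (x / 2) * ((∑ n ∈ Finset.Ioc 0 ⌊Real.exp (a + x)⌋₊, (Λ n : ℝ) / n) + ψ (Real.exp (a - x)))
        + Real.exp (-(x / 2)) * (ψ (Real.exp (a + x)) + ∑ n ∈ Finset.Ioc 0 ⌊Real.exp (a - x)⌋₊, (Λ n : ℝ) / n)) / 2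
      ≤ (α * Real.exp a + 2 * a + K + 39 / 50) * Real.cosh (x / 2) := by
  have hp0 : 0 ≤ a + x := by linarith [hx.1]
  have hq0 : 0 ≤ a - x := by linarith [hx.2]
  have hp1 : 1 ≤ Real.exp (a + x) := Real.one_le_exp hp0
  have hq1 : 1 ≤ Real.exp (a - x) := Real.one_le_exp hq0
  have hMp := Literature.NumberTheory.LFunctions.MertensFirstUpper.sum_vonMangoldt_div_floor_le_log_add hp1
  have hMm := Literature.NumberTheory.LFunctions.MertensFirstUpper.sum_vonMangoldt_div_floor_le_log_add hq1
  have hψp := hψ _ hp1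
  have hψm := hψ _ hq1
  rw [Real.log_exp] at hMp hMm
  have hE : 0 < Real.exp (x / 2) := Real.exp_pos _
  have hE' : 0 < Real.exp (-(x / 2)) := Real.exp_pos _
  have hex1 : Real.exp (x / 2) * Real.exp (a - x) = Real.exp a * Real.exp (-(x / 2)) := by
    rw [← Real.exp_add, ← Real.exp_add]; ring_nf
  have hex2 : Real.exp (-(x / 2)) * Real.exp (a + x) = Real.exp a * Real.exp (x / 2) := by
    rw [← Real.exp_add, ← Real.exp_add]; ring_nf
  have hlin := linear_terms_le hx (K + 39 / 50)
  have hup : Real.exp (x / 2) * ((∑ n ∈ Finset.Ioc 0 ⌊Real.exp (a + x)⌋₊, (Λ n : ℝ) / n) + ψ (Real.exp (a - x)))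
        + Real.exp (-(x / 2)) * (ψ (Real.exp (a + x)) + ∑ n ∈ Finset.Ioc 0 ⌊Real.exp (a - x)⌋₊, (Λ n : ℝ) / n)
      ≤ Real.exp (x / 2) * ((a + x + 39 / 50) + (α * Real.exp (a - x) + K))
        + Real.exp (-(x / 2)) * ((α * Real.exp (a + x) + K) + (a - x + 39 / 50)) := by
    gcongr
  refine (div_le_div_of_nonneg_right hup (by norm_num : (0 : ℝ) ≤ 2)).trans ?_
  rw [Real.cosh_eq]
  have h1 : Real.exp (x / 2) * (α * Real.exp (a - x)) = α * Real.exp a * Real.exp (-(x / 2)) := by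
    rw [← mul_assoc, mul_comm (Real.exp (x / 2)) α, mul_assoc, hex1]; ring
  have h2 : Real.exp (-(x / 2)) * (α * Real.exp (a + x)) = α * Real.exp a * Real.exp (x / 2) := by
    rw [← mul_assoc, mul_comm (Real.exp (-(x / 2))) α, mul_assoc, hex2]; ring
  nlinarith [h1, h2, hlin]

/-- **An upper bound of the floor from any linear majorant of `ψ`**: for `a > 0`, `ψ(X) ≤ αX + K` on `X ≥ 1` implies
`λ_max(a) ≤ α·e^a + 2a + K + 39/50` (Schur test with the weight `cosh(x/2)`). -/
theorem farCoercivityFloor_le_linear (ha : 0 < a) {α K : ℝ} (hψ : ∀ X : ℝ, 1 ≤ X → ψ X ≤ α * X + K) :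
    farCoercivityFloor a ≤ α * Real.exp a + 2 * a + K + 39 / 50 := by
  have hw : Measurable fun y : ℝ ↦ Real.cosh (y / 2) := Real.continuous_cosh.measurable.comp (measurable_id.div_const 2)
  refine farCoercivityFloor_le_of_rangeBound ha (N := ⌈Real.exp (2 * a)⌉₊) (Nat.le_ceil _) fun f C hf hC hsupp ↦ ?_
  refine shiftBound_range_of_schur hw (c := 1) (Cw := Real.cosh (a / 2)) one_pos (fun x _ ↦ Real.one_le_cosh _)
    (fun x hx ↦ Real.cosh_le_cosh.2 ?_) (fun x hx ↦ (schurSum_cosh_le hx _).trans (schurBound_cosh_linear hψ hx)) hf hC hsupp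
  rw [abs_div, abs_div, abs_two]
  exact div_le_div_of_nonneg_right ((abs_le.2 ⟨hx.1, hx.2⟩).trans (le_abs_self a)) (by norm_num)

/-! ## §2 The prime number theorem as linear majorants / minorants of `ψ`
(`ψ(x)/x → 1` is the tree's `Literature.NumberTheory.Transcendental.tendsto_psi_div`, from
`Literature.NumberTheory.LFunctions.chebyshevPsi_isEquivalent_holds`, Wiener–Ikehara) -/

/-- PNT from above, globally: for every `ε > 0` there is `K ≥ 0` with `ψ(X) ≤ (1 + ε)X + K` for all `X ≥ 1`. -/
theorem psi_le_linear_of_pnt {ε : ℝ} (hε : 0 < ε) : ∃ K : ℝ, 0 ≤ K ∧ ∀ X : ℝ, 1 ≤ X → ψ X ≤ (1 + ε) * X + K := by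
  have h := Literature.NumberTheory.Transcendental.tendsto_psi_div.eventually (Iio_mem_nhds (show (1 : ℝ) < 1 + ε by linarith))
  obtain ⟨X₀, hX₀⟩ := Filter.eventually_atTop.1 (h.and (eventually_gt_atTop 0))
  refine ⟨ψ (max X₀ 1), Chebyshev.psi_nonneg _, fun X hX ↦ ?_⟩
  have hX0 : 0 < X := by linarith
  rcases le_or_gt (max X₀ 1) X with hle | hlt
  · obtain ⟨h1, -⟩ := hX₀ X ((le_max_left _ _).trans hle)
    have : ψ X < (1 + ε) * X := by
      have h1' : ψ X / X < 1 + ε := h1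
      rwa [div_lt_iff₀ hX0] at h1'
    linarith [Chebyshev.psi_nonneg (max X₀ 1)]
  · have h1 : ψ X ≤ ψ (max X₀ 1) := Chebyshev.psi_mono hlt.le
    have h2 : 0 ≤ (1 + ε) * X := by positivity
    linarith

/-- PNT from below, eventually: for every `ε > 0`, `(1 − ε)X ≤ ψ(X)` for all `X ≥ X₀` (some `X₀ ≥ 1`). -/
theorem psi_ge_linear_of_pnt {ε : ℝ} (hε : 0 < ε) : ∃ X₀ : ℝ, 1 ≤ X₀ ∧ ∀ X : ℝ, X₀ ≤ X → (1 - ε) * X ≤ ψ X := by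
  have h := Literature.NumberTheory.Transcendental.tendsto_psi_div.eventually (Ioi_mem_nhds (show 1 - ε < (1 : ℝ) by linarith))
  obtain ⟨X₀, hX₀⟩ := Filter.eventually_atTop.1 (h.and (eventually_gt_atTop 0))
  refine ⟨max X₀ 1, le_max_right _ _, fun X hX ↦ ?_⟩
  obtain ⟨h1, hX0⟩ := hX₀ X ((le_max_left _ _).trans hX)
  have : (1 - ε) * X < ψ X := by
    have h1' : 1 - ε < ψ X / X := h1
    rwa [lt_div_iff₀ hX0] at h1'
  exact this.le

/-! ## §3 The floor from above: `λ_max(a) ≤ (1 + ε)e^a + O_ε(a)` -/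

/-- **Upper asymptotic**: for every `ε > 0` there is `K` with `λ_max(a) ≤ (1 + ε)e^a + 2a + K` for all `a > 0`. -/
theorem farCoercivityFloor_le_of_pnt {ε : ℝ} (hε : 0 < ε) :
    ∃ K : ℝ, ∀ a : ℝ, 0 < a → farCoercivityFloor a ≤ (1 + ε) * Real.exp a + 2 * a + K := by
  obtain ⟨K, -, hK⟩ := psi_le_linear_of_pnt hε
  exact ⟨K + 39 / 50, fun a ha ↦ by linarith [farCoercivityFloor_le_linear ha hK]⟩

/-! ## §4 The floor from below: `λ_max(a) ≥ (1 − ε)e^a` eventually (cosh test function + PNT) -/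

/-- PNT integrated: `∫_{(1,X]} ψ(t)/t dt ≥ (1 − ε)(X − X₀)` for `X ≥ X₀`. -/
theorem integral_inv_mul_psi_ge_of_pnt {ε : ℝ} (hε : 0 < ε) :
    ∃ X₀ : ℝ, 1 ≤ X₀ ∧ ∀ X : ℝ, X₀ ≤ X → (1 - ε) * (X - X₀) ≤ ∫ t in Ioc 1 X, t⁻¹ * ψ t := by
  obtain ⟨X₀, hX₀1, hX₀⟩ := psi_ge_linear_of_pnt hε
  refine ⟨X₀, hX₀1, fun X hX ↦ ?_⟩
  have hsub : Ioc X₀ X ⊆ Ioc 1 X := Ioc_subset_Ioc_left hX₀1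
  have hnn : 0 ≤ᵐ[volume.restrict (Ioc 1 X)] fun t : ℝ ↦ t⁻¹ * ψ t := by
    filter_upwards [ae_restrict_mem measurableSet_Ioc] with t ht
    exact mul_nonneg (inv_nonneg.2 (by linarith [ht.1])) (Chebyshev.psi_nonneg _)
  have hmono : ∫ t in Ioc X₀ X, t⁻¹ * ψ t ≤ ∫ t in Ioc 1 X, t⁻¹ * ψ t :=
    setIntegral_mono_set (integrableOn_inv_mul_psi X) hnn (Eventually.of_forall hsub)
  refine le_trans ?_ hmono
  have hconst : ∫ _ in Ioc X₀ X, (1 - ε) = (1 - ε) * (X - X₀) := by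
    rw [setIntegral_const, Real.volume_real_Ioc_of_le (by linarith), smul_eq_mul, mul_comm]
  rw [← hconst]
  refine setIntegral_mono_on ((continuousOn_const.integrableOn_Icc).mono_set Ioc_subset_Icc_self)
    ((integrableOn_inv_mul_psi X).mono_set hsub) measurableSet_Ioc fun t ht ↦ ?_
  have ht0 : 0 < t := by linarith [ht.1]
  have h := hX₀ t ht.1.le
  rw [show t⁻¹ * ψ t = ψ t / t by ring, le_div_iff₀ ht0]
  linarith

/-- The prime sum of the `cosh(x/2)` test from below by `−e^{−a}ψ(e^{2a}) + ½∫_{(1,e^{2a}]} ψ(t)/t dt`. -/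
theorem primeShiftForm_coshTest_ge (a : ℝ) :
    -Real.exp (-a) * ψ (Real.exp (2 * a)) + (∫ t in Ioc 1 (Real.exp (2 * a)), t⁻¹ * ψ t) / 2
      ≤ primeShiftForm a ((Icc (-a) a).indicator (fun y ↦ Real.cosh (y / 2))) := by
  rw [primeShiftForm_coshTest a]
  set X := ⌊Real.exp (2 * a)⌋₊ with hX
  have hψX : ψ (Real.exp (2 * a)) = ∑ n ∈ Finset.Ioc 0 X, (Λ n : ℝ) := rfl
  have hW : ∫ t in Ioc 1 (Real.exp (2 * a)), t⁻¹ * ψ t = ∑ n ∈ Finset.Ioc 0 X, (2 * a - Real.log n) * (Λ n : ℝ) := by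
    rw [← sum_vonMangoldt_mul_log_div_eq_integral, Real.log_exp, ← hX]
    rw [← Finset.sum_subset (Finset.Ioc_subset_Icc_self) fun n hn hn' ↦ by
      have h0 : n = 0 := by rw [Finset.mem_Icc] at hn; rw [Finset.mem_Ioc] at hn'; omega
      subst h0; simp]
  rw [hψX, hW, Finset.mul_sum, Finset.sum_div, ← Finset.sum_add_distrib]
  refine Finset.sum_le_sum fun n hn ↦ ?_
  rw [Finset.mem_Ioc] at hn
  have hn0 : (0 : ℝ) < n := by exact_mod_cast hn.1
  have hlog : Real.log n ≤ 2 * a := by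
    rw [Real.log_le_iff_le_exp hn0]
    exact (Nat.cast_le.2 hn.2).trans (Nat.floor_le (Real.exp_pos _).le)
  have hΛ : 0 ≤ (Λ n : ℝ) := ArithmeticFunction.vonMangoldt_nonneg
  have h1n : 0 ≤ 1 / (n : ℝ) := by positivity
  have hE : 0 ≤ Real.exp a / n := by positivity
  nlinarith [mul_nonneg hΛ (mul_nonneg (by linarith : 0 ≤ 2 * a - Real.log n) h1n), mul_nonneg hΛ hE]

/-- **Lower asymptotic**: for every `ε > 0`, `(1 − ε)e^a ≤ λ_max(a)` for all large `a`. -/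
theorem farCoercivityFloor_ge_of_pnt {ε : ℝ} (hε : 0 < ε) :
    ∀ᶠ a : ℝ in atTop, (1 - ε) * Real.exp a ≤ farCoercivityFloor a := by
  -- work with δ = min ε 1 / 4 ∈ (0, 1/4]
  set δ := min ε 1 / 4 with hδ
  have hδ0 : 0 < δ := by rw [hδ]; positivity
  have hδ1 : δ ≤ 1 / 4 := by rw [hδ]; linarith [min_le_right ε 1]
  have hδε : 3 * δ ≤ ε := by rw [hδ]; linarith [min_le_left ε 1]
  obtain ⟨K, hK0, hK⟩ := psi_le_linear_of_pnt hδ0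
  obtain ⟨X₀, hX₀1, hX₀⟩ := integral_inv_mul_psi_ge_of_pnt hδ0
  -- eventually: e^{2a} ≥ X₀ and a + 2 + K + X₀ ≤ δ e^a
  have hsmall : Tendsto (fun a : ℝ ↦ (a + (2 + K + X₀)) * Real.exp (-a)) atTop (𝓝 0) := by
    have h1 := Real.tendsto_pow_mul_exp_neg_atTop_nhds_zero 1
    have h2 := Real.tendsto_exp_neg_atTop_nhds_zero.const_mul (2 + K + X₀)
    have h := h1.add h2
    rw [mul_zero, zero_add] at h
    refine h.congr fun a ↦ ?_
    ring
  have hev1 : ∀ᶠ a : ℝ in atTop, (a + (2 + K + X₀)) * Real.exp (-a) < δ := hsmall.eventually (gt_mem_nhds hδ0)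
  have hev2 : ∀ᶠ a : ℝ in atTop, X₀ ≤ Real.exp (2 * a) :=
    (Real.tendsto_exp_atTop.comp (tendsto_id.const_mul_atTop (by norm_num : (0:ℝ) < 2))).eventually
      (eventually_ge_atTop X₀)
  filter_upwards [hev1, hev2, eventually_ge_atTop (1 : ℝ)] with a ha1 ha2 ha
  obtain ⟨hm, hb, hs⟩ := coshTest_admissible a
  set χ := (Icc (-a) a).indicator (fun y ↦ Real.cosh (y / 2)) with hχ
  set E := Real.exp a with hEdef
  have hEpos : 0 < E := Real.exp_pos a
  have hE1 : 1 ≤ E := Real.one_le_exp (by linarith)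
  have hE2 : Real.exp (2 * a) = E ^ 2 := by rw [hEdef, ← Real.exp_nat_mul]; norm_num
  have hEEm : E * Real.exp (-a) = 1 := by rw [hEdef, ← Real.exp_add]; simp
  have hEm1 : Real.exp (-a) ≤ 1 := Real.exp_le_one_iff.2 (by linarith)
  -- the norm and the quotient
  have hnorm : ∫ x, χ x ^ 2 = a + Real.sinh a := integral_coshTest_sq (by linarith)
  have hsinh : Real.sinh a ≤ E / 2 := by rw [Real.sinh_eq]; linarith [Real.exp_pos (-a)]
  have hsinh0 : 0 ≤ Real.sinh a := Real.sinh_nonneg_iff.2 (by linarith)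
  have hpos : 0 < ∫ x, χ x ^ 2 := by rw [hnorm]; linarith
  have hle : primeShiftForm a χ / ∫ x, χ x ^ 2 ≤ farCoercivityFloor a :=
    le_csSup (primeShiftQuotients_bddAbove a) ⟨χ, Real.cosh (a / 2), hm, hb, hs, hpos, rfl⟩
  refine le_trans ?_ hle
  rw [le_div_iff₀ hpos, hnorm]
  refine le_trans ?_ (primeShiftForm_coshTest_ge a)
  -- the PNT bounds at X = e^{2a}
  have hψ : ψ (Real.exp (2 * a)) ≤ (1 + δ) * E ^ 2 + K := by
    rw [← hE2]; exact hK (Real.exp (2 * a)) (Real.one_le_exp (by linarith))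
  have hW : (1 - δ) * (E ^ 2 - X₀) ≤ ∫ t in Ioc 1 (Real.exp (2 * a)), t⁻¹ * ψ t := by
    rw [← hE2]; exact hX₀ (Real.exp (2 * a)) ha2
  -- a + 2 + K + X₀ ≤ δ E
  have hkey : a + (2 + K + X₀) ≤ δ * E := by
    have h1 : (a + (2 + K + X₀)) * Real.exp (-a) * E ≤ δ * E := mul_le_mul_of_nonneg_right ha1.le hEpos.le
    have h2 : (a + (2 + K + X₀)) * Real.exp (-a) * E = a + (2 + K + X₀) := by
      rw [mul_assoc, mul_comm (Real.exp (-a)) E, hEEm, mul_one]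
    linarith
  -- assemble
  have hψ' : Real.exp (-a) * ψ (Real.exp (2 * a)) ≤ (1 + δ) * E + K := by
    calc Real.exp (-a) * ψ (Real.exp (2 * a)) ≤ Real.exp (-a) * ((1 + δ) * E ^ 2 + K) :=
          mul_le_mul_of_nonneg_left hψ (Real.exp_pos _).le
      _ = (1 + δ) * E * (E * Real.exp (-a)) + Real.exp (-a) * K := by ring
      _ ≤ (1 + δ) * E + K := by rw [hEEm, mul_one]; nlinarith
  have hT : (1 - ε) * E * (a + Real.sinh a) ≤ (1 - 3 * δ) * E * (a + E / 2) := by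
    have h1 : (1 - ε) * E ≤ (1 - 3 * δ) * E := mul_le_mul_of_nonneg_right (by linarith) hEpos.le
    have h2 : 0 ≤ (1 - 3 * δ) * E := mul_nonneg (by linarith) hEpos.le
    calc (1 - ε) * E * (a + Real.sinh a) ≤ (1 - 3 * δ) * E * (a + Real.sinh a) :=
          mul_le_mul_of_nonneg_right h1 (by linarith)
      _ ≤ (1 - 3 * δ) * E * (a + E / 2) := mul_le_mul_of_nonneg_left (by linarith) h2
  refine hT.trans ?_
  nlinarith [hψ', hW, hkey, mul_nonneg hδ0.le hEpos.le, mul_nonneg (by linarith : (0:ℝ) ≤ 1 - 3 * δ) hEpos.le]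

/-! ## §5 The floor law at leading order -/

/-- **THE FLOOR LAW AT LEADING ORDER (unconditional)**: `λ_max(a)/e^a → 1` as `a → ∞`. -/
theorem tendsto_farCoercivityFloor_div_exp :
    Tendsto (fun a : ℝ ↦ farCoercivityFloor a / Real.exp a) atTop (𝓝 1) := by
  rw [tendsto_order]
  refine ⟨fun b hb ↦ ?_, fun b hb ↦ ?_⟩
  · filter_upwards [farCoercivityFloor_ge_of_pnt (ε := (1 - b) / 2) (by linarith)] with a ha
    rw [lt_div_iff₀ (Real.exp_pos a)]
    nlinarith [Real.exp_pos a]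
  · obtain ⟨K, hK⟩ := farCoercivityFloor_le_of_pnt (ε := (b - 1) / 3) (by linarith)
    have h0 : Tendsto (fun a : ℝ ↦ (2 * a + K) * Real.exp (-a)) atTop (𝓝 0) := by
      have h1 := (Real.tendsto_pow_mul_exp_neg_atTop_nhds_zero 1).const_mul 2
      have h2 := Real.tendsto_exp_neg_atTop_nhds_zero.const_mul K
      have h := h1.add h2
      rw [mul_zero, mul_zero, zero_add] at h
      refine h.congr fun a ↦ ?_
      ring
    filter_upwards [h0.eventually (gt_mem_nhds (show 0 < (b - 1) / 3 by linarith)), eventually_gt_atTop (0 : ℝ)]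
      with a ha ha0
    rw [div_lt_iff₀ (Real.exp_pos a)]
    have h1 := hK a ha0
    have hEEm : Real.exp a * Real.exp (-a) = 1 := by rw [← Real.exp_add]; simp
    have h2 : 2 * a + K < (b - 1) / 3 * Real.exp a := by
      have := mul_lt_mul_of_pos_right ha (Real.exp_pos a)
      rwa [mul_assoc, mul_comm (Real.exp (-a)), hEEm, mul_one] at this
    nlinarith [Real.exp_pos a]

/-- **Corollary**: `λ_max(a)/L(a) → 1`, `L = pntFloor` the floor law's main term (`FloorMainTerm.tendsto_pntFloor_div_exp`). -/
theorem tendsto_farCoercivityFloor_div_pntFloor :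
    Tendsto (fun a : ℝ ↦ farCoercivityFloor a / pntFloor a) atTop (𝓝 1) := by
  have h := tendsto_farCoercivityFloor_div_exp.div FloorMainTerm.tendsto_pntFloor_div_exp one_ne_zero
  rw [div_one] at h
  refine h.congr' ?_
  filter_upwards [eventually_gt_atTop (0 : ℝ)] with a ha
  have hE : Real.exp a ≠ 0 := (Real.exp_pos a).ne'
  have hL : 0 < pntFloor a := by
    obtain ⟨hκ, -⟩ := FloorGrowth.sInf_pntKappaSet_spec ha
    unfold pntFloor pntKappa
    have : 0 < sInf {κ : ℝ | 1 / 2 < κ ∧ 1 / 2 ≤ κ * Real.tanh (κ * a)} ^ 2 - 1 / 4 := by nlinarith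
    exact one_div_pos.2 this
  rw [Pi.div_apply, div_div_div_cancel_right₀ hE]

/-- **Corollary (the floor law C-XIII at relative order `o(1)`)**: `(λ_max(a) − (L(a) − 2γ_E))/e^a → 0`. -/
theorem tendsto_farFloorDiscrepancy_div_exp :
    Tendsto (fun a : ℝ ↦ (farCoercivityFloor a - (pntFloor a - 2 * Real.eulerMascheroniConstant)) / Real.exp a)
      atTop (𝓝 0) := by
  have h1 := tendsto_farCoercivityFloor_div_exp
  have h2 := FloorMainTerm.tendsto_pntFloor_div_exp
  have h3 := Real.tendsto_exp_neg_atTop_nhds_zero.const_mul (2 * Real.eulerMascheroniConstant)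
  have h := (h1.sub h2).add h3
  rw [sub_self, mul_zero, zero_add] at h
  refine h.congr fun a ↦ ?_
  rw [Real.exp_neg]
  field_simp
  ring

end FloorAsymptotic

end Summit.RiemannHypothesis.RiemannHypothesis.Theorems.WeilFormatC
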